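import Summits.AnomalousDissipation.AnomalousDissipation.Theorems.NeutralTaylorWavesTaylorWaveQuasiSteadyHierarchy
import Summits.AnomalousDissipation.AnomalousDissipation.Theorems.NeutralTaylorWavesTaylorWaveQuasiSteadyStubFormalExpansionW
import Summits.AnomalousDissipation.AnomalousDissipation.Theorems.NeutralTaylorWavesTaylorWaveQuasiSteadyStubTruncationW
import Summits.AnomalousDissipation.AnomalousDissipation.Theorems.NeutralTaylorWavesTaylorWaveQuasiSteadyStubResidualTransferW
import Summits.AnomalousDissipation.AnomalousDissipation.Theorems.NeutralTaylorWavesTaylorWaveQuasiSteadyStubDissipationLawW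

/-!
# Crux `TaylorWaveQuasiSteady` (stmt-AnomalousDissipation-16293, route NeutralTaylorWaves, rank 3) — line `windfibred`
# (lead's skeleton, rev 3b: `stub_profilesW` factored through the ε-free formal hierarchy; T1, T2 LANDED)

Rev 3 (line lead prover-line-stmt-AnomalousDissipation-16293-c1-0, 2026-08-17).  Rev 2 (lead 0) had reduced the crux by
landed theorems to ONE open registered stub, `stub_profilesW` (all-orders general-phase profile construction at every
level `n`), judged crux-sized.  Rev 3 RESHAPES that stub at the skeleton level into three registered stubs with the same
composition idea (polynomial BKW ansatz `P = ∑_{a≤N} ε^a P_a`; vocabulary `sDeriv`, `fDeriv`, `divCoeff`, `hierarchyCoeff` and the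
composition `hierarchy_glue` in
`Theorems/NeutralTaylorWavesTaylorWaveQuasiSteadyHierarchy.lean`):

* `stub_hierarchyW` — OPEN CORE, now ε-FREE and n-FREE: one force `f`, phase data `(j, i₀, G)`, `E`, `ε₀ > 0`, and for
  every order `N` smooth axis-invariant profile families `P_a : T⁴ → ℝ³`, `Q_a : T⁴ → ℝ`, reals `c_a` (`a ≤ N`) solving the
  steady monophase hierarchy `hierarchyCoeff … s = 0 (s ≤ N)`, the formal incompressibility `divCoeff … s = 0 (s ≤ N+1)`,
  with zero horizontal `T⁴`-means, leading pointwise energy `‖P_0‖² ≤ E` and leading loudness `∫ |k|²‖∂_θP_0‖² = ε₀`.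
  It is EQUIVALENT to `stub_profilesW` restricted to axis-invariant polynomial-in-ε profiles with n-independent
  coefficients (a polynomial in `ε` that is `O(ε^{K+1})` along `ε_n → 0` has vanishing low coefficients), i.e. it is the
  crux's construction in Cheverry–Guès–Métivier form; size XL/open (leading order nonlinear at `O(1)` amplitude).
* `stub_formalExpansionW` — LANDED (p164827): the two LAURENT EXPANSIONS `ε·tsDiv ε (∑ ε^a P_a) = ∑_s ε^s divCoeff s` and
  `ε·tsResidual ε … = ∑_s ε^s hierarchyCoeff s` on the truncated sums `y ↦ ∑_{a<N+1} ε^a • P a y`, plus their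
  smoothness and `∂ ∑ = ∑ ∂` (pure algebra over the linearity of `Torus.partialDeriv`; size M).
* `stub_truncationW` — LANDED (p165336): formal solutions ⇒ `stub_profilesW` (size M): at level `n` take the truncated sums with
  `N := K`, i.e. `P := ∑_{a≤K} ε_n^a P_a` (and `P := 0` for the finitely many `n` below a threshold), bound the tail `∑_{s>N} ε^{s-1} M_s` by compactness,
  exact incompressibility from `divCoeff = 0`, exact horizontal means by axis-invariance (averaging lemma of
  `DissipationLaw` with Lipschitz constant `0`), loudness `∫dissDensity(P) = ε₀ + O(ε)`.
* `stub_dissipationLawW`, `stub_residualTransferW` — LANDED (rev 2).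

The statements below are the registered signatures verbatim; `stub_profilesW` is now a THEOREM of the three new stubs,
and the skeleton closes the crux by name through the landed `TaylorWaveQuasiSteady_of`.  See `Lines/windfibred.md`,
`PICKED.md` (rev 3 addendum) and the lead's `NOTES.md`.
-/

-- `Summit.<Summit>.<Problem>`: single-conjunct summit, the duplicate namespace component is mandated (CONVENTIONS §2).
set_option linter.dupNamespace false

noncomputable section

open scoped BigOperators InnerProductSpace
open Filter Set Topology MeasureTheory
open Summit.AnomalousDissipation.AnomalousDissipation.Theorems.TaylorWaveQuasiSteady

namespace Summit.AnomalousDissipation.AnomalousDissipation.Cruxes.TaylorWaveQuasiSteady.Windfibred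

/-- **stub H — THE ε-FREE FORMAL HIERARCHY (open core of the crux; size XL).** Registered signature verbatim.
For every order `N`: axis-invariant smooth profile families solving `hierarchyCoeff = 0` up to `s = N` and
`divCoeff = 0` up to `s = N + 1`, zero horizontal means, leading energy/loudness. -/
theorem stub_hierarchyW :
    ∃ (j : Fin 3 → ℤ) (i₀ : Fin 3) (G : UnitAddTorus (Fin 3) → ℝ) (f : UnitAddTorus (Fin 3) → EuclideanSpace ℝ (Fin 3)) (E ε₀ : ℝ), j i₀ ≠ 0 ∧ Literature.Analysis.FunctionSpaces.Torus.IsSmooth G ∧ (∀ x, Literature.Analysis.FunctionSpaces.Torus.partialDeriv i₀ G x = 0) ∧ Literature.Analysis.FunctionSpaces.Torus.IsSmooth f ∧ Literature.Analysis.FunctionSpaces.Torus.IsDivFree f ∧ Literature.Analysis.FunctionSpaces.Torus.HasZeroMean f ∧ 0 < ε₀ ∧ ∀ N : ℕ, ∃ (P : ℕ → UnitAddTorus (Fin 4) → EuclideanSpace ℝ (Fin 3)) (Q : ℕ → UnitAddTorus (Fin 4) → ℝ) (c : ℕ → ℝ), (∀ a, Literature.Analysis.FunctionSpaces.Torus.IsSmooth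 (P a)) ∧ (∀ a, Literature.Analysis.FunctionSpaces.Torus.IsSmooth (Q a)) ∧ (∀ a y, sDeriv i₀ (P a) y = 0) ∧ (∀ a, (∫ y, P a y) 0 = 0 ∧ (∫ y, P a y) 1 = 0) ∧ (∀ y, ‖P 0 y‖ ^ 2 ≤ E) ∧ (∫ y, dissDensity j G (P 0) y) = ε₀ ∧ (∀ s, s ≤ N + 1 → ∀ y, divCoeff j G N P s y = 0) ∧ (∀ s, s ≤ N → ∀ y, hierarchyCoeff j G f N P Q c s y = 0) := by
  sorry

/-- **stub T1 — FORMAL LAURENT EXPANSION of the two-scale divergence and residual on the polynomial ansatz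
(pure algebra; size M) — LANDED** (`Theorems/NeutralTaylorWavesTaylorWaveQuasiSteadyStubFormalExpansionW.lean`,
p164827). Registered signature verbatim; proof = the landed `FormalExpansion.stub_formalExpansionW`. -/
theorem stub_formalExpansionW :
    ∀ (j : Fin 3 → ℤ) (G : UnitAddTorus (Fin 3) → ℝ) (f : UnitAddTorus (Fin 3) → EuclideanSpace ℝ (Fin 3)) (N : ℕ) (P : ℕ → UnitAddTorus (Fin 4) → EuclideanSpace ℝ (Fin 3)) (Q : ℕ → UnitAddTorus (Fin 4) → ℝ) (c : ℕ → ℝ) (ε : ℝ), Literature.Analysis.FunctionSpaces.Torus.IsSmooth G → (∀ a, Literature.Analysis.FunctionSpaces.Torus.IsSmooth (P a)) → (∀ a, Literature.Analysis.FunctionSpaces.Torus.IsSmooth (Q a)) → Literature.Analysis.FunctionSpaces.Torus.IsSmooth (fun y => ∑ a ∈ Finset.range (N + 1), ε ^ a • P a y) ∧ Literature.Analysis.FunctionSpaces.Torus.IsSmooth (fun y => ∑ a ∈ Finset.range (N + 1), ε ^ a * Q a y) ∧ (∀ (m : Fin 4) (y : UnitAddTorus (Fin 4)), Literature.Analysis.FunctionSpaces.Torus.partialDeriv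 m (fun y => ∑ a ∈ Finset.range (N + 1), ε ^ a • P a y) y = ∑ a ∈ Finset.range (N + 1), ε ^ a • Literature.Analysis.FunctionSpaces.Torus.partialDeriv m (P a) y) ∧ (ε ≠ 0 → ∀ y : UnitAddTorus (Fin 4), ε * tsDiv ε j G (fun y => ∑ a ∈ Finset.range (N + 1), ε ^ a • P a y) y = ∑ s ∈ Finset.range (N + 2), ε ^ s * divCoeff j G N P s y ∧ ε • tsResidual ε j G f (fun y => ∑ a ∈ Finset.range (N + 1), ε ^ a • P a y) (fun y => ∑ a ∈ Finset.range (N + 1), ε ^ a * Q a y) (∑ a ∈ Finset.range (N + 1), ε ^ a * c a) y = ∑ s ∈ Finset.range (2 * N + 4), ε ^ s • hierarchyCoeff j G f N P Q c s y) :=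
  FormalExpansion.stub_formalExpansionW

/-- **stub T2 — TRUNCATION: formal solutions give the level-`n` profiles of `stub_profilesW` (size M) — LANDED**
(`Theorems/NeutralTaylorWavesTaylorWaveQuasiSteadyStubTruncationW.lean`, p165336). Registered signature verbatim
(`stub_formalExpansionW → stub_hierarchyW → stub_profilesW`); proof = the landed `Truncation.stub_truncationW`. -/
theorem stub_truncationW :
    (∀ (j : Fin 3 → ℤ) (G : UnitAddTorus (Fin 3) → ℝ) (f : UnitAddTorus (Fin 3) → EuclideanSpace ℝ (Fin 3)) (N : ℕ) (P : ℕ → UnitAddTorus (Fin 4) → EuclideanSpace ℝ (Fin 3)) (Q : ℕ → UnitAddTorus (Fin 4) → ℝ) (c : ℕ → ℝ) (ε : ℝ), Literature.Analysis.FunctionSpaces.Torus.IsSmooth G → (∀ a, Literature.Analysis.FunctionSpaces.Torus.IsSmooth (P a)) → (∀ a, Literature.Analysis.FunctionSpaces.Torus.IsSmooth (Q a)) → Literature.Analysis.FunctionSpaces.Torus.IsSmooth (fun y => ∑ a ∈ Finset.range (N + 1), ε ^ a • P a y) ∧ Literature.Analysis.FunctionSpaces.Torus.IsSmooth (fun y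 => ∑ a ∈ Finset.range (N + 1), ε ^ a * Q a y) ∧ (∀ (m : Fin 4) (y : UnitAddTorus (Fin 4)), Literature.Analysis.FunctionSpaces.Torus.partialDeriv m (fun y => ∑ a ∈ Finset.range (N + 1), ε ^ a • P a y) y = ∑ a ∈ Finset.range (N + 1), ε ^ a • Literature.Analysis.FunctionSpaces.Torus.partialDeriv m (P a) y) ∧ (ε ≠ 0 → ∀ y : UnitAddTorus (Fin 4), ε * tsDiv ε j G (fun y => ∑ a ∈ Finset.range (N + 1), ε ^ a • P a y) y = ∑ s ∈ Finset.range (N + 2), ε ^ s * divCoeff j G N P s y ∧ ε • tsResidual ε j G f (fun y => ∑ a ∈ Finset.range (N + 1), ε ^ a • P a y) (fun y => ∑ a ∈ Finset.range (N + 1), ε ^ a * Q a y) (∑ a ∈ Finset.range (N + 1), ε ^ a * c a) y = ∑ s ∈ Finset.range (2 * N + 4), ε ^ s • hierarchyCoeff j G f N P Q c s y)) → (∃ (j : Fin 3 → ℤ) (i₀ : Fin 3) (G : UnitAddTorus (Fin 3) → ℝ) (f : UnitAddTorus (Fin 3) → EuclideanSpace ℝ (Fin 3)) (E ε₀ : ℝ),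 j i₀ ≠ 0 ∧ Literature.Analysis.FunctionSpaces.Torus.IsSmooth G ∧ (∀ x, Literature.Analysis.FunctionSpaces.Torus.partialDeriv i₀ G x = 0) ∧ Literature.Analysis.FunctionSpaces.Torus.IsSmooth f ∧ Literature.Analysis.FunctionSpaces.Torus.IsDivFree f ∧ Literature.Analysis.FunctionSpaces.Torus.HasZeroMean f ∧ 0 < ε₀ ∧ ∀ N : ℕ, ∃ (P : ℕ → UnitAddTorus (Fin 4) → EuclideanSpace ℝ (Fin 3)) (Q : ℕ → UnitAddTorus (Fin 4) → ℝ) (c : ℕ → ℝ), (∀ a, Literature.Analysis.FunctionSpaces.Torus.IsSmooth (P a)) ∧ (∀ a, Literature.Analysis.FunctionSpaces.Torus.IsSmooth (Q a)) ∧ (∀ a y, sDeriv i₀ (P a) y = 0) ∧ (∀ a, (∫ y, P a y) 0 = 0 ∧ (∫ y, P a y) 1 = 0) ∧ (∀ y, ‖P 0 y‖ ^ 2 ≤ E) ∧ (∫ y, dissDensity j G (P 0) y) = ε₀ ∧ (∀ s, s ≤ N + 1 → ∀ y, divCoeff j G N P s y = 0) ∧ (∀ s, s ≤ N → ∀ y,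 hierarchyCoeff j G f N P Q c s y = 0)) → (∃ (j : Fin 3 → ℤ) (i₀ : Fin 3) (G : UnitAddTorus (Fin 3) → ℝ) (f : UnitAddTorus (Fin 3) → EuclideanSpace ℝ (Fin 3)) (E ε₀ : ℝ), j i₀ ≠ 0 ∧ Literature.Analysis.FunctionSpaces.Torus.IsSmooth G ∧ (∀ x, Literature.Analysis.FunctionSpaces.Torus.partialDeriv i₀ G x = 0) ∧ Literature.Analysis.FunctionSpaces.Torus.IsSmooth f ∧ Literature.Analysis.FunctionSpaces.Torus.IsDivFree f ∧ Literature.Analysis.FunctionSpaces.Torus.HasZeroMean f ∧ 0 < ε₀ ∧ ∀ K : ℕ, ∃ C : ℝ, ∀ n : ℕ, ∃ (P : UnitAddTorus (Fin 4) → EuclideanSpace ℝ (Fin 3)) (Q : UnitAddTorus (Fin 4) → ℝ) (c : ℝ), Literature.Analysis.FunctionSpaces.Torus.IsSmooth P ∧ Literature.Analysis.FunctionSpaces.Torus.IsSmooth Q ∧ |c| ≤ C ∧ (∀ y, ‖P y‖ ^ 2 ≤ E) ∧ (∀ (i : Fin 3) y, ‖Literature.Analysis.FunctionSpaces.Torus.partialDeriv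 i.castSucc P y‖ ≤ C) ∧ (∀ y, ‖Literature.Analysis.FunctionSpaces.Torus.partialDeriv (Fin.last 3) P y‖ ≤ C) ∧ (∀ (i : Fin 3) y, ‖Literature.Analysis.FunctionSpaces.Torus.partialDeriv i.castSucc (Literature.Analysis.FunctionSpaces.Torus.partialDeriv (Fin.last 3) P) y‖ ≤ C) ∧ |(∫ y, dissDensity j G P y) - ε₀| ≤ C * epsN n ∧ (∫ x, P (phaseMap j G n x)) 0 = 0 ∧ (∫ x, P (phaseMap j G n x)) 1 = 0 ∧ (∀ y, tsDiv (epsN n) j G P y = 0) ∧ (∀ y, ‖tsResidual (epsN n) j G f P Q c y‖ ^ 2 ≤ C * nuN n ^ K)) :=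
  Truncation.stub_truncationW

/-- **stub 1 of rev 1/2 — now a THEOREM of the three stubs above** (registered signature verbatim). -/
theorem stub_profilesW :
    ∃ (j : Fin 3 → ℤ) (i₀ : Fin 3) (G : UnitAddTorus (Fin 3) → ℝ) (f : UnitAddTorus (Fin 3) → EuclideanSpace ℝ (Fin 3)) (E ε₀ : ℝ), j i₀ ≠ 0 ∧ Literature.Analysis.FunctionSpaces.Torus.IsSmooth G ∧ (∀ x, Literature.Analysis.FunctionSpaces.Torus.partialDeriv i₀ G x = 0) ∧ Literature.Analysis.FunctionSpaces.Torus.IsSmooth f ∧ Literature.Analysis.FunctionSpaces.Torus.IsDivFree f ∧ Literature.Analysis.FunctionSpaces.Torus.HasZeroMean f ∧ 0 < ε₀ ∧ ∀ K : ℕ, ∃ C : ℝ, ∀ n : ℕ, ∃ (P : UnitAddTorus (Fin 4) → EuclideanSpace ℝ (Fin 3)) (Q : UnitAddTorus (Fin 4) → ℝ) (c : ℝ), Literature.Analysis.FunctionSpaces.Torus.IsSmooth P ∧ Literature.Analysis.FunctionSpaces.Torus.IsSmooth Q ∧ |c| ≤ C ∧ (∀ y, ‖P y‖ ^ 2 ≤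 E) ∧ (∀ (i : Fin 3) y, ‖Literature.Analysis.FunctionSpaces.Torus.partialDeriv i.castSucc P y‖ ≤ C) ∧ (∀ y, ‖Literature.Analysis.FunctionSpaces.Torus.partialDeriv (Fin.last 3) P y‖ ≤ C) ∧ (∀ (i : Fin 3) y, ‖Literature.Analysis.FunctionSpaces.Torus.partialDeriv i.castSucc (Literature.Analysis.FunctionSpaces.Torus.partialDeriv (Fin.last 3) P) y‖ ≤ C) ∧ |(∫ y, dissDensity j G P y) - ε₀| ≤ C * epsN n ∧ (∫ x, P (phaseMap j G n x)) 0 = 0 ∧ (∫ x, P (phaseMap j G n x)) 1 = 0 ∧ (∀ y, tsDiv (epsN n) j G P y = 0) ∧ (∀ y, ‖tsResidual (epsN n) j G f P Q c y‖ ^ 2 ≤ C * nuN n ^ K) :=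
  stub_truncationW stub_formalExpansionW stub_hierarchyW

/-- **stub 2 — TAYLOR DISSIPATION LAW, general phase (size M) — LANDED.** Registered signature verbatim. Proof = the landed `DissipationLaw.stub_dissipationLawW`. -/
theorem stub_dissipationLawW :
    ∀ (j : Fin 3 → ℤ) (i₀ : Fin 3) (G : UnitAddTorus (Fin 3) → ℝ) (M : ℝ), j i₀ ≠ 0 → Literature.Analysis.FunctionSpaces.Torus.IsSmooth G → (∀ x, Literature.Analysis.FunctionSpaces.Torus.partialDeriv i₀ G x = 0) → ∃ C₁ : ℝ, ∀ (n : ℕ) (P : UnitAddTorus (Fin 4) → EuclideanSpace ℝ (Fin 3)), Literature.Analysis.FunctionSpaces.Torus.IsSmooth P → (∀ (i : Fin 3) y, ‖Literature.Analysis.FunctionSpaces.Torus.partialDeriv i.castSucc P y‖ ≤ M) → (∀ y, ‖Literature.Analysis.FunctionSpaces.Torus.partialDeriv (Fin.last 3) P y‖ ≤ M) → (∀ (i : Fin 3) y, ‖Literature.Analysis.FunctionSpaces.Torus.partialDeriv i.castSucc (Literature.Analysis.FunctionSpaces.Torus.partialDeriv (Fin.last 3) P) y‖ ≤ M) → |nuN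 n * Literature.Analysis.FunctionSpaces.Torus.gradNormSq (fun x => P (phaseMap j G n x)) - ∫ y, dissDensity j G P y| ≤ C₁ * epsN n :=
  DissipationLaw.stub_dissipationLawW

/-- **stub 3 — TWO-SCALE EVALUATION / RESIDUAL TRANSFER (size M) — LANDED.** Registered signature verbatim;
proof = the landed `ResidualTransfer.stub_residualTransferW` (p159632). -/
theorem stub_residualTransferW :
    ∀ (j : Fin 3 → ℤ) (G : UnitAddTorus (Fin 3) → ℝ) (f : UnitAddTorus (Fin 3) → EuclideanSpace ℝ (Fin 3)) (E C : ℝ) (K : ℕ), Literature.Analysis.FunctionSpaces.Torus.IsSmooth G → ∃ C₂ : ℝ, ∀ (n : ℕ) (P : UnitAddTorus (Fin 4) → EuclideanSpace ℝ (Fin 3)) (Q : UnitAddTorus (Fin 4) → ℝ) (c : ℝ), Literature.Analysis.FunctionSpaces.Torus.IsSmooth P → Literature.Analysis.FunctionSpaces.Torus.IsSmooth Q → |c| ≤ C → (∀ y, ‖P y‖ ^ 2 ≤ E) → (∫ x, P (phaseMap j G n x)) 0 = 0 → (∫ x, P (phaseMap j G n x)) 1 = 0 → (∀ y, tsDiv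 (epsN n) j G P y = 0) → (∀ y, ‖tsResidual (epsN n) j G f P Q c y‖ ^ 2 ≤ C * nuN n ^ K) → ∃ (w : UnitAddTorus (Fin 3) → EuclideanSpace ℝ (Fin 3)) (q : UnitAddTorus (Fin 3) → ℝ) (c' : ℝ), Literature.Analysis.FunctionSpaces.Torus.IsSmooth w ∧ Literature.Analysis.FunctionSpaces.Torus.IsSmooth q ∧ Literature.Analysis.FunctionSpaces.Torus.IsDivFree w ∧ Literature.Analysis.FunctionSpaces.Torus.HasZeroMean w ∧ |c'| ≤ C₂ ∧ MeasureTheory.integral MeasureTheory.volume (fun x => ‖w x‖ ^ 2) ≤ E ∧ Literature.Analysis.FunctionSpaces.Torus.gradNormSq w = Literature.Analysis.FunctionSpaces.Torus.gradNormSq (fun x => P (phaseMap j G n x)) ∧ MeasureTheory.integral MeasureTheory.volume (fun x => ‖Literature.Analysis.FunctionSpaces.Torus.convect w w x - (nuN n) • Literature.Analysis.FunctionSpaces.Torus.laplacian w x + Literature.Analysis.FunctionSpaces.Torus.gradient q x - c' • Literature.Analysis.FunctionSpaces.Torus.partialDeriv (2 : Fin 3) w x - f x‖ ^ 2) ≤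 C₂ * (nuN n) ^ K :=
  ResidualTransfer.stub_residualTransferW

/-- **The skeleton in its rev-3 shape**: the crux BY NAME from the registered stubs through the landed, sorry-free
composition `Theorems.TaylorWaveQuasiSteady.TaylorWaveQuasiSteady_of` (p158245) applied to `stub_profilesW`, itself now
`stub_truncationW stub_formalExpansionW stub_hierarchyW`; depends on `sorryAx` through the ONE open stub `stub_hierarchyW` ONLY. -/
theorem TaylorWaveQuasiSteady_skeleton :
    Summit.AnomalousDissipation.AnomalousDissipation.Theses.NeutralTaylorWaves.TaylorWaveQuasiSteady :=
  TaylorWaveQuasiSteady_of stub_profilesW stub_dissipationLawW stub_residualTransferW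

/-- The same through the rev-3 composition `TaylorWaveQuasiSteady_of_hierarchy` (documentation of the cut). -/
example : Summit.AnomalousDissipation.AnomalousDissipation.Theses.NeutralTaylorWaves.TaylorWaveQuasiSteady :=
  hierarchy_glue stub_hierarchyW (stub_truncationW stub_formalExpansionW)

end Summit.AnomalousDissipation.AnomalousDissipation.Cruxes.TaylorWaveQuasiSteady.Windfibred

end
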